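import Mathlib
import Summits.NavierStokesRegularity.NavierStokesRegularity.Theorems.TypeILiouvilleLatticeCrux
import Summits.NavierStokesRegularity.NavierStokesRegularity.Theses.TypeTwoEternal

/-!
# TypeILiouvilleLatticeEternal — the ETERNAL LIOUVILLE crux (`Theses.TypeTwoEternal.EternalLiouville`,
# stmt-NavierStokesRegularity-18161; the «EL» door of (L) = stmt-10661) ON THE LATTICE-PERIODIC STRATUM

Helper for stmt-NavierStokesRegularity-10661 (`--supports`; the landed door order is (L) ⟹ EL,
`TypeILiouvilleQuiescentShadow.eternalLiouville_of_liouvilleL`); theorems only, no definitions, no named-fact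
hypotheses; closes no item; Navier–Stokes regularity is NOT proved here (leafhand seat of the
EulerZoomLiouville route, LAND-ONLY).

* `eternalLiouville_onLatticePeriodic` — binders of `Theses.TypeTwoEternal.EternalLiouville` VERBATIM (a bounded,
  jointly smooth field on `ℝ × ℝ³` with measurable slices all of whose time translates are ancient mild
  solutions of the duality class) plus «every slice is `ℤ³`-periodic» ⟹ every slice is one constant vector.
  Proof: exactly the landed edge `eternalLiouville_of_liouvilleL`, with (L) replaced by its periodic stratum
  `TypeILiouvilleLatticeMomentum.liouvilleL_onLatticePeriodic` (the translate `s ↦ v(s + t + 1)` is a bounded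
  ancient mild solution with periodic slices, hence a.e. constant on the slice `s = −1`; continuity).

[cite: KochNadirashviliSereginSverak2009, §1 conjecture (L), §4 p. 8 (arXiv:0709.3599)]
-/

noncomputable section
open MeasureTheory Filter Set Function Metric
open scoped Topology
open Literature.Analysis Literature.Analysis.FunctionSpaces Literature.Analysis.FluidPDE
set_option linter.dupNamespace false
namespace Summit.NavierStokesRegularity.NavierStokesRegularity.Theorems.TypeILiouvilleLatticeMomentum

/-- **ETERNAL LIOUVILLE on the lattice-periodic stratum** (binders of `Theses.TypeTwoEternal.EternalLiouville`
verbatim, plus periodicity of every slice): such a field is spatially constant on every slice.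
[cite: KochNadirashviliSereginSverak2009, §1 conjecture (L) and §4 p. 8 (arXiv:0709.3599)] -/
theorem eternalLiouville_onLatticePeriodic
    (v : ℝ → EuclideanSpace ℝ (Fin 3) → EuclideanSpace ℝ (Fin 3))
    (hanc : ∀ τ : ℝ, IsAncientMildSolution 1 (fun t => v (t + τ)))
    (hbd : ∃ C : ℝ, ∀ t x, ‖v t x‖ ≤ C)
    (hmeas : ∀ t, AEStronglyMeasurable (v t) volume)
    (hsm : ContDiff ℝ (⊤ : ℕ∞) (Function.uncurry v))
    (hper : ∀ t, Torus.IsLatticePeriodic (v t)) :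
    ∀ t : ℝ, ∃ b : EuclideanSpace ℝ (Fin 3), ∀ x, v t x = b := by
  intro t
  obtain ⟨C, hC⟩ := hbd
  have hw : IsBoundedAncientMildSolution 1 (fun s => v (s + (t + 1))) :=
    ⟨hanc (t + 1), ⟨C, fun s _ x => hC _ _⟩⟩
  have hwper : ∀ s < 0, ∀ j : Fin 3,
      (fun x => (fun s => v (s + (t + 1))) s (x + EuclideanSpace.single j 1)) =ᵐ[volume]
        (fun s => v (s + (t + 1))) s := by
    intro s _ j
    exact Filter.EventuallyEq.of_eq (funext fun x => hper (s + (t + 1)) j x)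
  obtain ⟨b, hb⟩ := liouvilleL_onLatticePeriodic (fun s => v (s + (t + 1))) hw (fun s _ => hmeas _) hwper
    (-1) (by norm_num)
  have ht : (-1 : ℝ) + (t + 1) = t := by ring
  have hae : v t =ᵐ[volume] fun _ => b := by simpa only [ht] using hb
  have hcont : Continuous (v t) :=
    hsm.continuous.comp (continuous_const.prodMk continuous_id)
  have heq : v t = fun _ => b := (Continuous.ae_eq_iff_eq volume hcont continuous_const).1 hae
  exact ⟨b, fun x => congrFun heq x⟩

end Summit.NavierStokesRegularity.NavierStokesRegularity.Theorems.TypeILiouvilleLatticeMomentum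

end
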